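import Literature.MathematicalPhysics.QuantumFieldTheory.Balaban1983to89.B8Eq155KLevelLocal
import Literature.MathematicalPhysics.QuantumFieldTheory.Balaban1983to89.B8Prop7ClassAkDomainSeq

/-!
# `Balaban1983to89.B8Eq155KLevelLiteral` — [Balaban1985RegularSpaces] Sect. B p. 86: (1.55) at `k` levels WITH (1.41) IN THE
# LITERAL p. 77 BOND CONVENTION along an admissible family (1.3)/(1.4) — the located reading (i) of `B8Eq155KLevelLocal`
# (cell GAPS G-B8-16) DISCHARGED at the price of the printed constants (`α₂ ↦ Lα₂`, gradient datum `g ↦ L²g`)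

statement-level skeleton of published theorems with citation tags; proofs where landed; nothing here is a claim about the Yang–Mills mass gap

T. Bałaban, *Spaces of regular gauge field configurations on a lattice and gauge fixing conditions*, Commun.
Math. Phys. **99** (1985) 75–102 `[Balaban1985RegularSpaces]` ("B8"; printed page = PDF page + 74), p. 77 [PDF 3]
((1.3)–(1.5) and the bond convention), p. 83 [PDF 9] ((1.40)–(1.41)), p. 86 [PDF 12] ((1.55)).  PDF held:
`paper:balaban1985-cmp99-regular-spaces-gauge-fixing`.  STATUS: published, refereed.

CITATION HEADER (lean-in-tree rule).  Cell `pub-ymgap` (YM Track A, DAG node N05 = [B8], HUMAN RULING D-0062), seat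
`pub-ymgap-dag-n05-b`, gen 0; companion of `B8Eq155KLevelLocal` (same seat).  WHAT IS REPRODUCED = row **B8.Eq1.55** (norm form,
k levels, general background) with the hypothesis (1.41) «|A| < α₂(Lʲη)⁻¹ on Ω_j» read in print's LITERAL convention (p. 77:
a bond belongs to `Ω_j` iff one of its end-points does — `B8Ineq132.BondTouches`) instead of the one-layer-wider reading
`SideTouches (Ω j)` of `B8Eq140Level`/`B8Eq155KLevelLocal`.  MECHANISM = p40's for (1.140) (`B8Prop7ClassAkLiteral` /
`B8Prop7ClassAkDomainSeq`): along an admissible family (1.3)/(1.4) with `Ω₀ = T_η`, every side of a plaquette touching `Ω_{i+1}`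
touches `Ω_i` (`B8Prop7ClassAkDomainSeq.sideTouches_succ_bondTouches_of_domainSeq`), where the literal (1.41) holds with the
previous threshold `α₂(Lⁱη)⁻¹ = Lα₂(L^{i+1}η)⁻¹` (and a `(Lʲη)²`-weighted gradient datum `g` becomes `L²g`); so
`B8Eq155KLevelLocal.eq155_norm_kLevel` applies with `α₂ ↦ Lα₂`, `g ↦ L²g`.  Kind «kernel-checked proof», theorems only: no
`def`, no `… : Prop` fact, no existing module modified.  REUSED BY NAME: `B8Eq155KLevelLocal.{eq155_norm_kLevel,
eq155_norm_kLevel_hermitian}`, `B8Prop7ClassAkDomainSeq.sideTouches_succ_bondTouches_of_domainSeq`, `B8ConstraintBonds.DomainSeq`,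
`B8Eq140Level.SideTouches`, `B8Ineq132.{InAk, BondTouches}`, `B8ScaledSupNorm.bondNorm`.

## THE PRINTED TEXT (p. 77, p. 83, p. 86)

p. 77: «If Ω ⊂ T_η, then we denote by Ω also the set of bonds ⋃_{x∈Ω} st(x) = {bonds b ⊂ T_η: at least one end-point of b
belongs to Ω}.»; (1.3)–(1.4): the nested family `Ω₀ ⊃ Ω₁ ⊃ … ⊃ Ω_k` with the distances `(Lʲη)⁻¹dist(Ω_jᶜ, Ω_{j+1}) > RM₁`.
p. 83: «U₁ = e^{iηA}, |A| < α₂(Lʲη)⁻¹ on Ω_j, (1.41)».  p. 86: «|J|_(−3) ≦ 2α₀ + 36dα₂|∇^η_{U₀}A|_(−2) + 50dα₂³ + 10dα₀α₂».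

## WHAT IS CERTIFIED HERE (kernel; axioms `propext` / `Classical.choice` / `Quot.sound`)

* §1 `bound_side_of_lit` — along a family with `Ω₀ = T_η` and `SideTouches (Ω (i+1)) ⊆ BondTouches (Ω i)` (`i < k`), the
  literal (1.41) at every level gives `|A(b)| ≤ Lα₂(Lʲη)⁻¹` on `SideTouches (Ω j)`, `j ≤ k`; `grad_side_of_lit` — a
  `(Lʲη)²`-weighted gradient bound `g` on the bonds touching `Ω_j` becomes `L²g` on `SideTouches (Ω j)`.
* §2 **`eq155_norm_kLevel_literal`** — (1.55), norm form at `k` levels, with (1.41) and the gradient datum in the LITERAL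
  convention: `|J|_(−3) ≤ 2α₀ + 36d(Lα₂)(L²g) + 50d(Lα₂)³ + 10dα₀(Lα₂)` (`16Lα₂ ≤ 1`, `5Lα₂(d − 1) ≤ 4`);
  `eq155_norm_kLevel_literal_hermitian` (Hermitian `A`); **`eq155_norm_kLevel_domainSeq`** — the same for an admissible family in
  the sense of the tree's (1.3)/(1.4) record `B8ConstraintBonds.DomainSeq L Ω` with `Ω₀ = T_η` (the nesting read off the record).

## HONEST SCOPE / LOCATED READING — what is NOT claimed

(i) The printed constants `36d`, `50d`, `10d` are replaced by `36dL³`, `50dL³`, `10dL` (the price of reading (1.41) literally;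
cell GAPS G-B8-16 records this as «changing the constants by L-dependent factors»); with the one-layer-wider reading they are
print's (`B8Eq155KLevelLocal`).  (ii) `Ω₀ = T_η` (print admits `Ω_j = T_η`, p. 77; at the bottom level there is no previous
level to borrow from).  (iii) Everything else as in `B8Eq155KLevelLocal` (its HONEST SCOPE (ii)–(vi)).
-/

noncomputable section

open scoped BigOperators
open NormedSpace

namespace Literature.MathematicalPhysics.QuantumFieldTheory.Balaban1983to89.B8Eq155KLevelLiteral

open B7Prop1Explicit (U1)
open B8Lemma1NonAbelian (mulCfg)
open B8Ineq132 (covDerivFwd InAk BondTouches)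
open B8Eq146AExpansion (iEta expCfg)
open B8Eq155JBound (Jcur)
open B8Eq140Level (SideTouches)
open B8ScaledSupNorm (bondNorm)
open B8ConstraintBonds (DomainSeq)
open B8Prop7ClassAkDomainSeq (sideTouches_succ_bondTouches_of_domainSeq)
open B8Eq155KLevelLocal (eq155_norm_kLevel eq155_norm_kLevel_hermitian)

-- `Site` alone would resolve to the torus sites of `Setup.lean`; re-export the `ℤ^d` sites of `B7Prop1Explicit`.
export B7Prop1Explicit (Site)

variable {d : ℕ}

/-! ## §1 From the literal convention to the sides of the plaquettes touching `Ω_j` -/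

section Transfer

variable {𝔸 : Type*} [NormedRing 𝔸] [NormedAlgebra ℂ 𝔸]

/-- The level arithmetic: `α(Lⁱη)⁻¹ = Lα(L^{i+1}η)⁻¹` and `((Lⁱη)⁻¹)⁻² … ` i.e. `(L^{i+1}η)² = L²(Lⁱη)²` (`L ≥ 1`, `η > 0`).
[cite: Balaban1985RegularSpaces, (1.41) p.83, (1.3)-(1.4) p.77] -/
theorem thr_prev {L : ℕ} (hL : 1 ≤ L) {η : ℝ} (hη : 0 < η) (α : ℝ) (i : ℕ) :
    α * ((L : ℝ) ^ i * η)⁻¹ = (L : ℝ) * α * ((L : ℝ) ^ (i + 1) * η)⁻¹ ∧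
      ((L : ℝ) ^ (i + 1) * η) ^ 2 = (L : ℝ) ^ 2 * ((L : ℝ) ^ i * η) ^ 2 := by
  have hL0 : (0 : ℝ) < L := by exact_mod_cast hL
  refine ⟨?_, by rw [pow_succ]; ring⟩
  rw [pow_succ]
  field_simp

omit [NormedAlgebra ℂ 𝔸] in
/-- **THE LITERAL (1.41) ALONG THE FAMILY GIVES `|A| ≤ Lα₂(Lʲη)⁻¹` ON `SideTouches (Ω j)`** (`Ω₀ = T_η`; one-layer nesting
`SideTouches (Ω (i+1)) ⊆ BondTouches (Ω i)`, `i < k`; `L ≥ 1`, `α₂ ≥ 0`). [cite: Balaban1985RegularSpaces, (1.41) p.83, p.77, (1.3)-(1.4) p.77] -/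
theorem bound_side_of_lit {L : ℕ} (hL : 1 ≤ L) {η : ℝ} (hη : 0 < η) {α₂ : ℝ} (hα₂ : 0 ≤ α₂) {k : ℕ}
    {Ω : ℕ → Set (Site d)} (hΩ₀ : Ω 0 = Set.univ)
    (hnest : ∀ i, i < k → ∀ (y : Site d) (τ : Fin d), SideTouches (Ω (i + 1)) y τ → BondTouches (Ω i) y τ)
    {A : Site d → Fin d → 𝔸}
    (h41 : ∀ j, j ≤ k → ∀ x μ, BondTouches (Ω j) x μ → ‖A x μ‖ ≤ α₂ * ((L : ℝ) ^ j * η)⁻¹)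
    (j : ℕ) (hj : j ≤ k) (y : Site d) (τ : Fin d) (hy : SideTouches (Ω j) y τ) :
    ‖A y τ‖ ≤ (L : ℝ) * α₂ * ((L : ℝ) ^ j * η)⁻¹ := by
  have hL1 : (1 : ℝ) ≤ L := by exact_mod_cast hL
  cases j with
  | zero =>
    have hb : BondTouches (Ω 0) y τ := by rw [hΩ₀]; exact Or.inl (Set.mem_univ y)
    refine (h41 0 hj y τ hb).trans ?_
    have hr : 0 ≤ ((L : ℝ) ^ 0 * η)⁻¹ := inv_nonneg.mpr (by positivity)
    nlinarith [mul_nonneg hα₂ hr]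
  | succ i =>
    have hb : BondTouches (Ω i) y τ := hnest i (by omega) y τ hy
    rw [← (thr_prev hL hη α₂ i).1]
    exact h41 i (by omega) y τ hb

/-- **A `(Lʲη)²`-WEIGHTED GRADIENT BOUND `g` ON THE BONDS TOUCHING `Ω_j` BECOMES `L²g` ON `SideTouches (Ω j)`** (same nesting).
[cite: Balaban1985RegularSpaces, (1.55) p.86, p.77, (1.3)-(1.4) p.77] -/
theorem grad_side_of_lit {L : ℕ} (hL : 1 ≤ L) {η : ℝ} (hη : 0 < η) {g : ℝ} (hg0 : 0 ≤ g) {k : ℕ}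
    {Ω : ℕ → Set (Site d)} (hΩ₀ : Ω 0 = Set.univ)
    (hnest : ∀ i, i < k → ∀ (y : Site d) (τ : Fin d), SideTouches (Ω (i + 1)) y τ → BondTouches (Ω i) y τ)
    {U₀ : Site d → Fin d → 𝔸ˣ} {A : Site d → Fin d → 𝔸}
    (hg : ∀ j, j ≤ k → ∀ (y : Site d) (κ τ : Fin d), BondTouches (Ω j) y τ →
      ((L : ℝ) ^ j * η) ^ 2 * ‖covDerivFwd η U₀ κ (fun z => A z τ) y‖ ≤ g)
    (j : ℕ) (hj : j ≤ k) (y : Site d) (κ τ : Fin d) (hy : SideTouches (Ω j) y τ) :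
    ((L : ℝ) ^ j * η) ^ 2 * ‖covDerivFwd η U₀ κ (fun z => A z τ) y‖ ≤ (L : ℝ) ^ 2 * g := by
  have hL1 : (1 : ℝ) ≤ L := by exact_mod_cast hL
  have hL2 : (1 : ℝ) ≤ (L : ℝ) ^ 2 := one_le_pow₀ hL1
  cases j with
  | zero =>
    have hb : BondTouches (Ω 0) y τ := by rw [hΩ₀]; exact Or.inl (Set.mem_univ y)
    refine (hg 0 hj y κ τ hb).trans ?_
    nlinarith
  | succ i =>
    have hb : BondTouches (Ω i) y τ := hnest i (by omega) y τ hy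
    have h := hg i (by omega) y κ τ hb
    rw [(thr_prev hL hη g i).2, mul_assoc]
    exact mul_le_mul_of_nonneg_left h (by positivity)

end Transfer

/-! ## §2 (1.55), norm form at `k` levels, with (1.41) in the literal convention -/

section KLevel

variable {𝔸 : Type*} [NormedRing 𝔸] [NormOneClass 𝔸] [NormedAlgebra ℂ 𝔸] [CompleteSpace 𝔸]

/-- **(1.55), NORM FORM AT `k` LEVELS, (1.41) AND THE GRADIENT DATUM IN THE LITERAL p. 77 CONVENTION**: for a family with
`Ω₀ = T_η` and the one-layer nesting `SideTouches (Ω (i+1)) ⊆ BondTouches (Ω i)` (`i < k`), `U₀` `U1`-valued, `U₁ = e^{iηA}`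
`U1`-valued with the bookkeeping `|U₁ − 1| ≤ Lα₂(Lʲη)⁻¹η` on `SideTouches (Ω j)`, (1.40) for `U₀` and `U₁U₀`, (1.41)
`|A(b)| ≤ α₂(Lʲη)⁻¹` for the bonds touching `Ω_j`, a gradient datum `g` with `(Lʲη)²|(D^η_{U₀,κ}A_τ)(y)| ≤ g` for the bonds
`⟨y, y + e_τ⟩` touching `Ω_j` (`j ≤ k`), and `16Lα₂ ≤ 1`, `5Lα₂(d − 1) ≤ 4`:
`|J|_(−3) ≤ 2α₀ + 36d(Lα₂)(L²g) + 50d(Lα₂)³ + 10dα₀(Lα₂)`. [cite: Balaban1985RegularSpaces, (1.55) p.86 (second form), (1.41) p.83, p.77] -/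
theorem eq155_norm_kLevel_literal {η : ℝ} (hη : 0 < η) {L : ℕ} (hL : 1 ≤ L) {k : ℕ} {U₀ : Site d → Fin d → 𝔸ˣ}
    (h₀ : ∀ y κ, U₀ y κ ∈ U1 𝔸) {A : Site d → Fin d → 𝔸} (h₁ : ∀ y κ, expCfg (iEta η A) y κ ∈ U1 𝔸)
    {α₀ α₂ g : ℝ} (hα₀ : 0 ≤ α₀) (hα₂ : 0 ≤ α₂) (h16 : 16 * ((L : ℝ) * α₂) ≤ 1)
    (hd5 : 5 * ((L : ℝ) * α₂) * ((d : ℝ) - 1) ≤ 4) (hg0 : 0 ≤ g) {Ω : ℕ → Set (Site d)} (hΩ₀ : Ω 0 = Set.univ)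
    (hnest : ∀ i, i < k → ∀ (y : Site d) (τ : Fin d), SideTouches (Ω (i + 1)) y τ → BondTouches (Ω i) y τ)
    (h40₀ : InAk L k η α₀ Ω U₀) (h40₁ : InAk L k η α₀ Ω (mulCfg (expCfg (iEta η A)) U₀))
    (h41 : ∀ j, j ≤ k → ∀ x μ, BondTouches (Ω j) x μ → ‖A x μ‖ ≤ α₂ * ((L : ℝ) ^ j * η)⁻¹)
    (hu : ∀ j, j ≤ k → ∀ y τ, SideTouches (Ω j) y τ →
      ‖(expCfg (iEta η A) y τ : 𝔸) - 1‖ ≤ (L : ℝ) * α₂ * ((L : ℝ) ^ j * η)⁻¹ * η)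
    (hg : ∀ j, j ≤ k → ∀ (y : Site d) (κ τ : Fin d), BondTouches (Ω j) y τ →
      ((L : ℝ) ^ j * η) ^ 2 * ‖covDerivFwd η U₀ κ (fun z => A z τ) y‖ ≤ g) :
    bondNorm L k η (-(3 : ℝ)) Ω (fun x μ => Jcur η U₀ A μ x) ≤
      2 * α₀ + 36 * d * ((L : ℝ) * α₂) * ((L : ℝ) ^ 2 * g) + 50 * d * ((L : ℝ) * α₂) ^ 3 +
        10 * d * α₀ * ((L : ℝ) * α₂) :=
  eq155_norm_kLevel hη hL h₀ h₁ hα₀ (by positivity) h16 hd5 (by positivity) h40₀ h40₁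
    (bound_side_of_lit hL hη hα₂ hΩ₀ hnest h41) hu (grad_side_of_lit hL hη hg0 hΩ₀ hnest hg)

end KLevel

section Hermitian

variable {𝔸 : Type*} [CStarAlgebra 𝔸] [Nontrivial 𝔸]

/-- **(1.55), NORM FORM AT `k` LEVELS, LITERAL CONVENTION, HERMITIAN `A`** (`U₁ = e^{iηA}` unitary, `|U₁ − 1| ≤ η|A|`
discharged). [cite: Balaban1985RegularSpaces, (1.55) p.86 (second form), (1.41) p.83, p.77] -/
theorem eq155_norm_kLevel_literal_hermitian {η : ℝ} (hη : 0 < η) {L : ℕ} (hL : 1 ≤ L) {k : ℕ}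
    {U₀ : Site d → Fin d → 𝔸ˣ} (h₀ : ∀ y κ, U₀ y κ ∈ U1 𝔸) {A : Site d → Fin d → 𝔸}
    (hAh : ∀ y κ, IsSelfAdjoint (A y κ)) {α₀ α₂ g : ℝ} (hα₀ : 0 ≤ α₀) (hα₂ : 0 ≤ α₂)
    (h16 : 16 * ((L : ℝ) * α₂) ≤ 1) (hd5 : 5 * ((L : ℝ) * α₂) * ((d : ℝ) - 1) ≤ 4) (hg0 : 0 ≤ g)
    {Ω : ℕ → Set (Site d)} (hΩ₀ : Ω 0 = Set.univ)
    (hnest : ∀ i, i < k → ∀ (y : Site d) (τ : Fin d), SideTouches (Ω (i + 1)) y τ → BondTouches (Ω i) y τ)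
    (h40₀ : InAk L k η α₀ Ω U₀) (h40₁ : InAk L k η α₀ Ω (mulCfg (expCfg (iEta η A)) U₀))
    (h41 : ∀ j, j ≤ k → ∀ x μ, BondTouches (Ω j) x μ → ‖A x μ‖ ≤ α₂ * ((L : ℝ) ^ j * η)⁻¹)
    (hg : ∀ j, j ≤ k → ∀ (y : Site d) (κ τ : Fin d), BondTouches (Ω j) y τ →
      ((L : ℝ) ^ j * η) ^ 2 * ‖covDerivFwd η U₀ κ (fun z => A z τ) y‖ ≤ g) :
    bondNorm L k η (-(3 : ℝ)) Ω (fun x μ => Jcur η U₀ A μ x) ≤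
      2 * α₀ + 36 * d * ((L : ℝ) * α₂) * ((L : ℝ) ^ 2 * g) + 50 * d * ((L : ℝ) * α₂) ^ 3 +
        10 * d * α₀ * ((L : ℝ) * α₂) :=
  eq155_norm_kLevel_hermitian hη hL h₀ hAh hα₀ (by positivity) h16 hd5 (by positivity) h40₀ h40₁
    (bound_side_of_lit hL hη hα₂ hΩ₀ hnest h41) (grad_side_of_lit hL hη hg0 hΩ₀ hnest hg)

/-- **(1.55), NORM FORM AT `k` LEVELS, LITERAL CONVENTION, FOR AN ADMISSIBLE FAMILY (1.3)/(1.4) OF THE TREE'S RECORD**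
(`B8ConstraintBonds.DomainSeq L Ω`, `Ω₀ = T_η`; Hermitian `A`): the one-layer nesting is READ OFF the record
(`B8Prop7ClassAkDomainSeq.sideTouches_succ_bondTouches_of_domainSeq`). [cite: Balaban1985RegularSpaces, (1.55) p.86, (1.3)-(1.4) p.77, (1.41) p.83] -/
theorem eq155_norm_kLevel_domainSeq {η : ℝ} (hη : 0 < η) {L : ℕ} (hL : 1 ≤ L) {k : ℕ}
    {U₀ : Site d → Fin d → 𝔸ˣ} (h₀ : ∀ y κ, U₀ y κ ∈ U1 𝔸) {A : Site d → Fin d → 𝔸}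
    (hAh : ∀ y κ, IsSelfAdjoint (A y κ)) {α₀ α₂ g : ℝ} (hα₀ : 0 ≤ α₀) (hα₂ : 0 ≤ α₂)
    (h16 : 16 * ((L : ℝ) * α₂) ≤ 1) (hd5 : 5 * ((L : ℝ) * α₂) * ((d : ℝ) - 1) ≤ 4) (hg0 : 0 ≤ g)
    {Ω : ℕ → Set (Site d)} (hΩ : DomainSeq L Ω) (hΩ₀ : Ω 0 = Set.univ)
    (h40₀ : InAk L k η α₀ Ω U₀) (h40₁ : InAk L k η α₀ Ω (mulCfg (expCfg (iEta η A)) U₀))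
    (h41 : ∀ j, j ≤ k → ∀ x μ, BondTouches (Ω j) x μ → ‖A x μ‖ ≤ α₂ * ((L : ℝ) ^ j * η)⁻¹)
    (hg : ∀ j, j ≤ k → ∀ (y : Site d) (κ τ : Fin d), BondTouches (Ω j) y τ →
      ((L : ℝ) ^ j * η) ^ 2 * ‖covDerivFwd η U₀ κ (fun z => A z τ) y‖ ≤ g) :
    bondNorm L k η (-(3 : ℝ)) Ω (fun x μ => Jcur η U₀ A μ x) ≤
      2 * α₀ + 36 * d * ((L : ℝ) * α₂) * ((L : ℝ) ^ 2 * g) + 50 * d * ((L : ℝ) * α₂) ^ 3 +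
        10 * d * α₀ * ((L : ℝ) * α₂) :=
  eq155_norm_kLevel_literal_hermitian hη hL h₀ hAh hα₀ hα₂ h16 hd5 hg0 hΩ₀
    (fun i _ => sideTouches_succ_bondTouches_of_domainSeq hL hΩ i) h40₀ h40₁ h41 hg

end Hermitian

#print axioms eq155_norm_kLevel_literal
#print axioms eq155_norm_kLevel_domainSeq

end Literature.MathematicalPhysics.QuantumFieldTheory.Balaban1983to89.B8Eq155KLevelLiteral

end
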